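import Mathlib
import HarnessLib

/-!
# May 1972 — divisor maps of Dedekind domains and of one-variable function fields

Field-theoretic lemmas for the proof of `May1972_units_fg_field_charP` (Karpilovsky 1988,
Thm 4.5.1 / Thm 4.1.21; W. May 1972), replacing Karpilovsky's "full set of valuations of `K`
trivial on `F`" (Lemma 4.1.20) by the height-one spectra of the two Dedekind domains
`B = integral closure of F[t]` and `B' = integral closure of F[t⁻¹]` in `K` (finite places and
places at infinity):

* `exists_divisorHom` : for a Dedekind domain `B` with fraction field `L`, the divisor map
  `Lˣ → ⊕_v ℤ`, `y ↦ (ord_v y)_v` (finite support), with kernel `Bˣ` (Karpilovsky Lemma 4.1.2: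
  "`F* ≅ U(R) × P(R)`, `P(R)` free").
* `exists_eq_algebraMap_of_mem_adjoin_of_mem_adjoin_inv` : `F[t] ∩ F[t⁻¹] = F` for `t`
  transcendental.
* `exists_divisorHom_adjoin`, `coeff_minpoly_mem_adjoin` and the one-variable theorem
  `exists_addMonoidHom_ker_eq_algebraic` (= Karpilovsky Thm 4.1.21 in the separable case): for
  `L` finite separable over `F(t)`, a map `Additive Lˣ →+ (S →₀ ℤ)` whose kernel is exactly the
  group of units algebraic over `F`, and finiteness of the algebraic closure of `F` in `L`.
-/

namespace Literature.NumberTheory.DiophantineGeometry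

namespace May1972

open Function Polynomial IsDedekindDomain IsDedekindDomain.HeightOneSpectrum

universe u v

/-- **Divisor map of a Dedekind domain** (Karpilovsky 1988, Lemma 4.1.2: for a Dedekind — even
Krull — domain `R` with quotient field `F`, `F* / U(R)` embeds in the free group of divisors):
`y ↦ (ord_v y)_v` is an additive map `Additive Lˣ →+ (HeightOneSpectrum B →₀ ℤ)` whose kernel
consists exactly of the units of `B`. [cite: Karpilovsky1988, Lemma 4.1.2] -/
theorem exists_divisorHom (B : Type u) (L : Type v) [CommRing B] [IsDedekindDomain B] [Field L]
    [Algebra B L] [IsFractionRing B L] :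
    ∃ f : Additive Lˣ →+ (HeightOneSpectrum B →₀ ℤ),
      ∀ y : Lˣ, f (Additive.ofMul y) = 0 ↔
        (y : L) ∈ (algebraMap B L).range ∧ ((y⁻¹ : Lˣ) : L) ∈ (algebraMap B L).range := by
  classical
  -- the valuations of a unit are `1` outside a finite set
  have hfin : ∀ y : Lˣ, (Function.support fun v : HeightOneSpectrum B =>
      Multiplicative.toAdd (v.valuationOfNeZero y)).Finite := by
    intro y
    apply ((HeightOneSpectrum.Support.finite B (y : L)).union
      (HeightOneSpectrum.Support.finite B ((y⁻¹ : Lˣ) : L))).subset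
    intro v hv
    rw [Function.mem_support] at hv
    have hv' : v.valuation L (y : L) ≠ 1 := by
      intro h
      apply hv
      have h1 : (v.valuationOfNeZero y : WithZero (Multiplicative ℤ)) =
          ((1 : Multiplicative ℤ) : WithZero (Multiplicative ℤ)) := by
        rw [valuationOfNeZero_eq, h]; rfl
      have h2 : v.valuationOfNeZero y = 1 := WithZero.coe_inj.mp h1
      rw [h2]; rfl
    rcases lt_or_gt_of_ne hv' with h | h
    · right
      show 1 < v.valuation L ((y⁻¹ : Lˣ) : L)
      rw [Units.val_inv_eq_inv_val, map_inv₀]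
      have h0 : 0 < v.valuation L (y : L) :=
        zero_lt_iff.mpr ((Valuation.ne_zero_iff _).mpr y.ne_zero)
      exact (one_lt_inv₀ h0).mpr h
    · left; exact h
  let f₀ : Lˣ → (HeightOneSpectrum B →₀ ℤ) := fun y =>
    Finsupp.ofSupportFinite (fun v => Multiplicative.toAdd (v.valuationOfNeZero y)) (hfin y)
  have hf₀ : ∀ y v, f₀ y v = Multiplicative.toAdd (v.valuationOfNeZero y) := fun y v => rfl
  let f : Additive Lˣ →+ (HeightOneSpectrum B →₀ ℤ) :=
    { toFun := fun a => f₀ (Additive.toMul a)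
      map_zero' := by
        ext v
        rw [hf₀]
        simp
      map_add' := by
        intro a b
        ext v
        simp only [hf₀, toMul_add, map_mul, toAdd_mul, Finsupp.coe_add, Pi.add_apply] }
  refine ⟨f, fun y => ?_⟩
  have key : f (Additive.ofMul y) = 0 ↔ ∀ v : HeightOneSpectrum B, v.valuation L (y : L) = 1 := by
    rw [← Finsupp.coe_eq_zero, funext_iff]
    apply forall_congr'
    intro v
    show Multiplicative.toAdd (v.valuationOfNeZero y) = 0 ↔ _
    rw [toAdd_eq_zero, ← WithZero.coe_inj, valuationOfNeZero_eq]
    rfl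
  rw [key]
  constructor
  · intro h
    refine ⟨mem_integers_of_valuation_le_one L (y : L) fun v => (h v).le,
      mem_integers_of_valuation_le_one L ((y⁻¹ : Lˣ) : L) fun v => ?_⟩
    rw [Units.val_inv_eq_inv_val, map_inv₀, h v, inv_one]
  · rintro ⟨⟨b, hb⟩, ⟨b', hb'⟩⟩ v
    have h1 : v.valuation L (y : L) ≤ 1 := hb ▸ v.valuation_le_one b
    have h2 : v.valuation L ((y⁻¹ : Lˣ) : L) ≤ 1 := hb' ▸ v.valuation_le_one b'
    have h3 : v.valuation L (y : L) * v.valuation L ((y⁻¹ : Lˣ) : L) = 1 := by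
      rw [← map_mul, Units.mul_inv, map_one]
    refine le_antisymm h1 ?_
    calc (1 : WithZero (Multiplicative ℤ)) = v.valuation L (y : L) * v.valuation L ((y⁻¹ : Lˣ) : L) := h3.symm
      _ ≤ v.valuation L (y : L) * 1 := mul_le_mul_right h2 _
      _ = v.valuation L (y : L) := mul_one _

/-- `F[t] ∩ F[t⁻¹] = F` inside any field, for `t` transcendental over `F`: an element that is
both a polynomial in `t` and a polynomial in `t⁻¹` is a constant (compare degrees in
`t ^ n · p(t) = q̃(t)`).  This is the fact "`v_∞(t) ≠ 1`" of Karpilovsky 1988, Lemma 4.1.19, in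
the form used here. [folklore] -/
theorem exists_eq_algebraMap_of_mem_adjoin_of_mem_adjoin_inv {K F : Type*} [Field K] [Field F]
    [Algebra K F] {t : F} (ht : Transcendental K t) {z : F}
    (h1 : z ∈ Algebra.adjoin K {t}) (h2 : z ∈ Algebra.adjoin K {t⁻¹}) :
    ∃ c : K, z = algebraMap K F c := by
  rw [Algebra.adjoin_singleton_eq_range_aeval] at h1 h2
  obtain ⟨p, rfl⟩ := h1
  obtain ⟨q, hq⟩ := h2
  have ht0 : t ≠ 0 := fun h => ht (h ▸ isAlgebraic_zero)
  by_cases hp : p = 0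
  · exact ⟨0, by simp [hp]⟩
  haveI : Invertible (t⁻¹) := invertibleOfNonzero (inv_ne_zero ht0)
  have hrev := eval₂_reverse_mul_pow (algebraMap K F) t⁻¹ q
  rw [invOf_eq_inv, inv_inv] at hrev
  -- `aeval t (reverse q) = aeval t (p * X ^ n)`
  have hn : aeval t q.reverse = aeval t (p * X ^ q.natDegree) := by
    change eval₂ (algebraMap K F) t⁻¹ q = aeval t p at hq
    rw [hq] at hrev
    rw [map_mul, map_pow, aeval_X, ← hrev, mul_assoc, ← mul_pow, inv_mul_cancel₀ ht0, one_pow,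
      mul_one]
    rfl
  have hinj : Function.Injective (aeval (R := K) t) := transcendental_iff_injective.mp ht
  have heq : q.reverse = p * X ^ q.natDegree := hinj hn
  have hdeg : (p * X ^ q.natDegree).natDegree ≤ q.natDegree := by
    rw [← heq]; exact reverse_natDegree_le q
  rw [natDegree_mul_X_pow (n := q.natDegree) (hp := hp)] at hdeg
  have hp0 : p.natDegree = 0 := by omega
  refine ⟨p.coeff 0, ?_⟩
  show aeval t p = algebraMap K F (p.coeff 0)
  conv_lhs => rw [eq_C_of_natDegree_eq_zero hp0]
  rw [aeval_C]

/-- Over an integrally closed domain `A` with fraction field `F`, an element of a finite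
extension `L/F` is integral over `A` iff its `F`-minimal polynomial has coefficients in `A`
(Gauss / `minpoly.isIntegrallyClosed_eq_field_fractions'`). [folklore] -/
theorem isIntegral_iff_coeff_minpoly_mem {A F L : Type*} [CommRing A] [IsDomain A]
    [IsIntegrallyClosed A] [Field F] [Field L] [Algebra A F] [IsFractionRing A F] [Algebra F L]
    [Algebra A L] [IsScalarTower A F L] [FiniteDimensional F L] (x : L) :
    IsIntegral A x ↔ ∀ i, (minpoly F x).coeff i ∈ (algebraMap A F).range := by
  constructor
  · intro hx i
    rw [minpoly.isIntegrallyClosed_eq_field_fractions' F hx, coeff_map]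
    exact ⟨_, rfl⟩
  · intro h
    have hxF : IsIntegral F x := Algebra.IsIntegral.isIntegral x
    have hlifts : minpoly F x ∈ Polynomial.lifts (algebraMap A F) := by
      rw [lifts_iff_coeff_lifts]
      intro n
      obtain ⟨a, ha⟩ := h n
      exact ⟨a, ha⟩
    obtain ⟨P, hP, -, hPmonic⟩ := lifts_and_degree_eq_and_monic hlifts (minpoly.monic hxF)
    refine ⟨P, hPmonic, ?_⟩
    have : aeval x P = 0 := by
      rw [← aeval_map_algebraMap F, hP, minpoly.aeval]
    exact this

section OneVariable

variable {K : Type u} {Kt : Type u} {L : Type v} [Field K] [Field Kt] [Field L]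
  [Algebra K Kt] [Algebra Kt L] [Algebra K L] [IsScalarTower K Kt L]

/-- If `t` is transcendental over `K` and generates the field `Kt` over `K`, then the subalgebra
`K[t] ⊆ Kt` is a principal ideal domain (`≅ K[X]`) with fraction field `Kt`. [folklore] -/
theorem adjoin_transcendental_aux (t : Kt) (ht : Transcendental K t)
    (hgen : IntermediateField.adjoin K {t} = ⊤) :
    IsPrincipalIdealRing (Algebra.adjoin K {t}) ∧ IsFractionRing (Algebra.adjoin K {t}) Kt := by
  constructor
  · let e := Polynomial.algEquivOfTranscendental K t ht
    exact IsPrincipalIdealRing.of_surjective e.toRingEquiv.toRingHom e.surjective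
  · haveI : FaithfulSMul (Algebra.adjoin K {t}) Kt :=
      (faithfulSMul_iff_algebraMap_injective _ Kt).mpr Subtype.val_injective
    refine IsFractionRing.of_field (Algebra.adjoin K {t}) Kt fun z => ?_
    have hz : z ∈ IntermediateField.adjoin K {t} := by rw [hgen]; trivial
    obtain ⟨r, hr, s, hs, hz⟩ := IntermediateField.mem_adjoin_iff_div.mp hz
    exact ⟨⟨r, hr⟩, ⟨s, hs⟩, hz⟩

/-- The minimal polynomial over `Kt = K(t)` of an element integral over `K` has coefficients in
`K[t]` (`K[t]` is integrally closed). [folklore] -/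
theorem coeff_minpoly_mem_adjoin [FiniteDimensional Kt L] (t : Kt) (ht : Transcendental K t)
    (hgen : IntermediateField.adjoin K {t} = ⊤) {y : L} (hy : IsIntegral K y) (i : ℕ) :
    (minpoly Kt y).coeff i ∈ Algebra.adjoin K {t} := by
  obtain ⟨hPID, hFrac⟩ := adjoin_transcendental_aux t ht hgen
  haveI := hPID
  haveI := hFrac
  haveI : IsScalarTower (Algebra.adjoin K {t}) Kt L := IsScalarTower.of_algebraMap_eq fun _ => rfl
  haveI : IsScalarTower K (Algebra.adjoin K {t}) L := IsScalarTower.of_algebraMap_eq fun c => by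
    show algebraMap K L c = algebraMap Kt L (algebraMap K Kt c)
    exact IsScalarTower.algebraMap_apply K Kt L c
  have hyA : IsIntegral (Algebra.adjoin K {t}) y := hy.tower_top
  obtain ⟨a, ha⟩ := (isIntegral_iff_coeff_minpoly_mem (F := Kt) y).mp hyA i
  rw [← ha]
  exact a.2

omit [Algebra K L] [IsScalarTower K Kt L] in
/-- **Divisor map of `K[u]`-integers** (Karpilovsky 1988, proof of Thm 4.1.21 with Lemma 4.1.20,
restricted to the places over `K[u]`): for `L` finite separable over `Kt = K(u)`, `u`
transcendental, the integral closure `B` of `K[u]` in `L` is a Dedekind domain with fraction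
field `L`, and its divisor map `Additive Lˣ →+ ⊕_v ℤ` has kernel `Bˣ`, i.e. the units `y` such
that `y` and `y⁻¹` have `K(u)`-minimal polynomial with coefficients in `K[u]`.
[cite: Karpilovsky1988, Lemma 4.1.20] -/
theorem exists_divisorHom_adjoin [FiniteDimensional Kt L] [Algebra.IsSeparable Kt L] (u : Kt)
    (hu : Transcendental K u) (hgen : IntermediateField.adjoin K {u} = ⊤) :
    ∃ (S : Type v) (f : Additive Lˣ →+ (S →₀ ℤ)), ∀ y : Lˣ, f (Additive.ofMul y) = 0 ↔
      (∀ i, (minpoly Kt (y : L)).coeff i ∈ Algebra.adjoin K {u}) ∧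
      (∀ i, (minpoly Kt ((y⁻¹ : Lˣ) : L)).coeff i ∈ Algebra.adjoin K {u}) := by
  obtain ⟨hPID, hFrac⟩ := adjoin_transcendental_aux u hu hgen
  haveI := hPID
  haveI := hFrac
  haveI : IsScalarTower (Algebra.adjoin K {u}) Kt L := IsScalarTower.of_algebraMap_eq fun _ => rfl
  set B := integralClosure (Algebra.adjoin K {u}) L with hB
  haveI : IsDedekindDomain B := integralClosure.isDedekindDomain (Algebra.adjoin K {u}) Kt L
  haveI : IsFractionRing B L :=
    integralClosure.isFractionRing_of_finite_extension (A := Algebra.adjoin K {u}) Kt L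
  obtain ⟨f, hf⟩ := exists_divisorHom B L
  refine ⟨HeightOneSpectrum B, f, fun y => ?_⟩
  rw [hf]
  have hrange : ∀ x : L, x ∈ (algebraMap B L).range ↔
      ∀ i, (minpoly Kt x).coeff i ∈ Algebra.adjoin K {u} := by
    intro x
    have h1 : x ∈ (algebraMap B L).range ↔ IsIntegral (Algebra.adjoin K {u}) x := by
      rw [← mem_integralClosure_iff]
      constructor
      · rintro ⟨b, rfl⟩; exact b.2
      · intro hx; exact ⟨⟨x, hx⟩, rfl⟩
    rw [h1, isIntegral_iff_coeff_minpoly_mem (F := Kt)]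
    apply forall_congr'
    intro i
    constructor
    · rintro ⟨a, ha⟩; rw [← ha]; exact a.2
    · intro h; exact ⟨⟨_, h⟩, rfl⟩
  rw [hrange, hrange]

/-- **The one-variable theorem** (Karpilovsky 1988, Thm 4.1.21, for `K/F(X)` finite SEPARABLE;
the book proves it for arbitrary finite `K/F(X)` with a full set of valuations): if `t` is
transcendental over `K`, `Kt = K(t)` and `L/Kt` is finite separable, there is an additive map from
`Additive Lˣ` to a free `ℤ`-module whose kernel is exactly the set of units of `L` algebraic
over `K` ("`K* ≅ L* × A`, `A` free, `L` the algebraic closure of `F` in `K`").  The map is the sum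
of the divisor maps of the integral closures of `K[t]` and `K[t⁻¹]`; the kernel computation is
`K[t] ∩ K[t⁻¹] = K`. [cite: Karpilovsky1988, Thm 4.1.21] -/
theorem exists_addMonoidHom_ker_eq_algebraic [FiniteDimensional Kt L] [Algebra.IsSeparable Kt L]
    (t : Kt) (ht : Transcendental K t) (hgen : IntermediateField.adjoin K {t} = ⊤) :
    ∃ (S : Type v) (f : Additive Lˣ →+ (S →₀ ℤ)),
      ∀ y : Lˣ, f (Additive.ofMul y) = 0 ↔ IsAlgebraic K (y : L) := by
  have ht' : Transcendental K t⁻¹ := fun h => ht (IsAlgebraic.inv_iff.mp h)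
  have hgen' : IntermediateField.adjoin K {t⁻¹} = ⊤ := by
    rw [eq_top_iff, ← hgen]
    apply IntermediateField.adjoin_simple_le_iff.mpr
    have := IntermediateField.mem_adjoin_simple_self K t⁻¹
    simpa using IntermediateField.inv_mem _ this
  obtain ⟨S₁, f₁, hf₁⟩ := exists_divisorHom_adjoin (L := L) t ht hgen
  obtain ⟨S₂, f₂, hf₂⟩ := exists_divisorHom_adjoin (L := L) t⁻¹ ht' hgen'
  let F : Additive Lˣ →+ (S₁ ⊕ S₂ →₀ ℤ) :=
    (Finsupp.sumFinsuppAddEquivProdFinsupp (M := ℤ) (α := S₁) (β := S₂)).symm.toAddMonoidHom.comp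
      (f₁.prod f₂)
  refine ⟨S₁ ⊕ S₂, F, fun y => ?_⟩
  have hF : F (Additive.ofMul y) = 0 ↔ f₁ (Additive.ofMul y) = 0 ∧ f₂ (Additive.ofMul y) = 0 := by
    simp only [F, AddMonoidHom.coe_comp, AddEquiv.coe_toAddMonoidHom, Function.comp_apply,
      EmbeddingLike.map_eq_zero_iff, AddMonoidHom.prod_apply, Prod.mk_eq_zero]
  rw [hF, hf₁, hf₂]
  constructor
  · rintro ⟨⟨h1, -⟩, ⟨h2, -⟩⟩
    -- all coefficients of `minpoly Kt y` are constants
    have hyKt : IsIntegral Kt (y : L) := Algebra.IsIntegral.isIntegral (y : L)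
    have hlifts : minpoly Kt (y : L) ∈ Polynomial.lifts (algebraMap K Kt) := by
      rw [lifts_iff_coeff_lifts]
      intro n
      obtain ⟨c, hc⟩ := exists_eq_algebraMap_of_mem_adjoin_of_mem_adjoin_inv ht (h1 n) (h2 n)
      exact ⟨c, hc.symm⟩
    obtain ⟨P, hP, -, hPmonic⟩ := lifts_and_degree_eq_and_monic hlifts (minpoly.monic hyKt)
    have hint : IsIntegral K (y : L) := by
      refine ⟨P, hPmonic, ?_⟩
      have : aeval (y : L) P = 0 := by
        rw [← aeval_map_algebraMap Kt, hP, minpoly.aeval]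
      exact this
    exact hint.isAlgebraic
  · intro hy
    have hy' : IsAlgebraic K ((y⁻¹ : Lˣ) : L) := by
      rw [Units.val_inv_eq_inv_val]
      exact IsAlgebraic.inv_iff.mpr hy
    exact ⟨⟨coeff_minpoly_mem_adjoin t ht hgen hy.isIntegral,
        coeff_minpoly_mem_adjoin t ht hgen hy'.isIntegral⟩,
      ⟨coeff_minpoly_mem_adjoin t⁻¹ ht' hgen' hy.isIntegral,
        coeff_minpoly_mem_adjoin t⁻¹ ht' hgen' hy'.isIntegral⟩⟩

/-- Abstract finiteness step: if `B` is module-finite over a `K`-algebra `A` in which every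
element is `c + t·a'` (`c ∈ K`), and `t` is not a unit of `B`, then every field `C` mapping
`K`-algebraically to `B` is finite over `K` (it embeds in the finite-dimensional `K`-algebra
`B / tB`). [folklore] -/
theorem finite_of_algHom_of_not_isUnit {K A B C : Type*} [Field K] [CommRing A] [Algebra K A]
    [CommRing B] [Algebra A B] [Algebra K B] [IsScalarTower K A B] [Module.Finite A B]
    [Field C] [Algebra K C] (tA : A)
    (hdecomp : ∀ a : A, ∃ (c : K) (a' : A), a = algebraMap K A c + tA * a')
    (hI : Ideal.span {algebraMap A B tA} ≠ ⊤) (g : C →ₐ[K] B) : Module.Finite K C := by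
  set I : Ideal B := Ideal.span {algebraMap A B tA} with hI_def
  haveI : Nontrivial (B ⧸ I) := Ideal.Quotient.nontrivial_iff.mpr hI
  -- `t` acts as zero on `B ⧸ I`
  have htzero : ∀ z : B ⧸ I, tA • z = 0 := by
    intro z
    rw [Algebra.smul_def, IsScalarTower.algebraMap_apply A B (B ⧸ I),
      Ideal.Quotient.algebraMap_eq,
      Ideal.Quotient.eq_zero_iff_mem.mpr (Ideal.mem_span_singleton_self _), zero_mul]
  -- `B ⧸ I` is finite over `K`
  haveI hfinK : Module.Finite K (B ⧸ I) := by
    obtain ⟨S, hS⟩ := Module.Finite.fg_top (R := A) (M := B ⧸ I)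
    refine ⟨⟨S, ?_⟩⟩
    rw [eq_top_iff]
    rintro v -
    have hv : v ∈ Submodule.span A (S : Set (B ⧸ I)) := hS ▸ Submodule.mem_top
    induction hv using Submodule.span_induction with
    | mem x hx => exact Submodule.subset_span hx
    | zero => exact zero_mem _
    | add x y _ _ hx hy => exact add_mem hx hy
    | smul a x _ hx =>
      obtain ⟨c, a', ha⟩ := hdecomp a
      rw [ha, add_smul, mul_smul, htzero, add_zero, algebraMap_smul]
      exact Submodule.smul_mem _ c hx
  let φ : C →ₐ[K] B ⧸ I := (Ideal.Quotient.mkₐ K I).comp g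
  exact Module.Finite.of_injective φ.toLinearMap (RingHom.injective φ.toRingHom)

/-- **Finiteness of the field of constants** (Karpilovsky 1988, Thm 4.1.21, first assertion:
"the extension `L/F` is finite", `L` the algebraic closure of `F` in `K`; there proved by a chain
argument, here by embedding the constants into `B / tB`, a finite-dimensional `K`-algebra, where
`B` is the integral closure of `K[t]`). [cite: Karpilovsky1988, Thm 4.1.21] -/
theorem finiteDimensional_algebraicClosure [FiniteDimensional Kt L] [Algebra.IsSeparable Kt L]
    (t : Kt) (ht : Transcendental K t) (hgen : IntermediateField.adjoin K {t} = ⊤) :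
    FiniteDimensional K (algebraicClosure K L) := by
  obtain ⟨hPID, hFrac⟩ := adjoin_transcendental_aux t ht hgen
  haveI := hPID
  haveI := hFrac
  haveI : IsScalarTower (Algebra.adjoin K {t}) Kt L := IsScalarTower.of_algebraMap_eq fun _ => rfl
  haveI : IsScalarTower K (Algebra.adjoin K {t}) L := IsScalarTower.of_algebraMap_eq fun c => by
    show algebraMap K L c = algebraMap Kt L (algebraMap K Kt c)
    exact IsScalarTower.algebraMap_apply K Kt L c
  haveI : IsDedekindDomain (integralClosure (Algebra.adjoin K {t}) L) :=
    integralClosure.isDedekindDomain (Algebra.adjoin K {t}) Kt L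
  haveI : IsScalarTower (Algebra.adjoin K {t}) (integralClosure (Algebra.adjoin K {t}) L) L :=
    IsScalarTower.of_algebraMap_eq fun _ => rfl
  haveI : Module.Finite (Algebra.adjoin K {t}) (integralClosure (Algebra.adjoin K {t}) L) :=
    IsIntegralClosure.finite (Algebra.adjoin K {t}) Kt L (integralClosure (Algebra.adjoin K {t}) L)
  haveI : IsScalarTower K (Algebra.adjoin K {t}) (integralClosure (Algebra.adjoin K {t}) L) :=
    IsScalarTower.of_algebraMap_eq fun c => Subtype.ext (IsScalarTower.algebraMap_apply K Kt L c)
  -- the generator `t ∈ K[t]`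
  let tA : Algebra.adjoin K {t} := ⟨t, Algebra.self_mem_adjoin_singleton K t⟩
  have ht0 : (t : Kt) ≠ 0 := fun h => ht (h ▸ isAlgebraic_zero)
  -- `t` is not a unit of `B` (else `t⁻¹ ∈ K[t] ∩ K[t⁻¹] = K`)
  have hI : Ideal.span {algebraMap (Algebra.adjoin K {t})
      (integralClosure (Algebra.adjoin K {t}) L) tA} ≠ ⊤ := by
    intro hI
    have h1 : (1 : integralClosure (Algebra.adjoin K {t}) L) ∈ Ideal.span {algebraMap
        (Algebra.adjoin K {t}) (integralClosure (Algebra.adjoin K {t}) L) tA} :=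
      hI ▸ Submodule.mem_top
    obtain ⟨b, hb⟩ := Ideal.mem_span_singleton'.mp h1
    have hbL : ((b : integralClosure (Algebra.adjoin K {t}) L) : L) * algebraMap Kt L t = 1 := by
      have h2 := congrArg (fun z : integralClosure (Algebra.adjoin K {t}) L => (z : L)) hb
      have h3 : ((b : integralClosure (Algebra.adjoin K {t}) L) : L) *
          algebraMap (Algebra.adjoin K {t}) L tA = 1 := by simpa using h2
      exact h3
    have hbL' : ((b : integralClosure (Algebra.adjoin K {t}) L) : L) = algebraMap Kt L t⁻¹ := by
      rw [map_inv₀]; exact eq_inv_of_mul_eq_one_left hbL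
    have hint : IsIntegral (Algebra.adjoin K {t}) (algebraMap Kt L t⁻¹) := hbL' ▸ b.2
    have hint' : IsIntegral (Algebra.adjoin K {t}) (t⁻¹ : Kt) :=
      (isIntegral_algebraMap_iff (algebraMap Kt L).injective).mp hint
    obtain ⟨a, ha⟩ := IsIntegrallyClosed.isIntegral_iff.mp hint'
    have hmem1 : (t⁻¹ : Kt) ∈ Algebra.adjoin K {t} := ha ▸ a.2
    have hmem2 : (t⁻¹ : Kt) ∈ Algebra.adjoin K {t⁻¹} := Algebra.self_mem_adjoin_singleton K _
    obtain ⟨c, hc⟩ := exists_eq_algebraMap_of_mem_adjoin_of_mem_adjoin_inv ht hmem1 hmem2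
    have halg : IsAlgebraic K (t⁻¹ : Kt) := hc ▸ isAlgebraic_algebraMap c
    exact ht (IsAlgebraic.inv_iff.mp halg)
  -- every `a ∈ K[t]` is `c + t·a'`
  have hdecomp : ∀ a : Algebra.adjoin K {t}, ∃ (c : K) (a' : Algebra.adjoin K {t}),
      a = algebraMap K _ c + tA * a' := by
    intro a
    let e := Polynomial.algEquivOfTranscendental K t ht
    obtain ⟨q, rfl⟩ := e.surjective a
    refine ⟨q.coeff 0, e q.divX, ?_⟩
    have hX : e X = tA := by
      rw [Polynomial.algEquivOfTranscendental_apply, aeval_X]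
    have hC : e (C (q.coeff 0)) = algebraMap K _ (q.coeff 0) := by
      rw [Polynomial.algEquivOfTranscendental_apply, aeval_C]
    conv_lhs => rw [← X_mul_divX_add q]
    rw [map_add, map_mul, hX, hC, add_comm]
  -- the constants map `K`-algebraically into `B`
  let ι : algebraicClosure K L →ₐ[K] integralClosure (Algebra.adjoin K {t}) L :=
    { toFun := fun x => ⟨x, by
        have hx : IsAlgebraic K (x : L) := (mem_algebraicClosure_iff).mp x.2
        exact hx.isIntegral.tower_top⟩
      map_one' := rfl
      map_mul' := fun _ _ => rfl
      map_zero' := rfl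
      map_add' := fun _ _ => rfl
      commutes' := fun _ => rfl }
  exact finite_of_algHom_of_not_isUnit tA hdecomp hI ι

end OneVariable

end May1972

end Literature.NumberTheory.DiophantineGeometry
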